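import Literature.Geometry.ComplexHyperbolic.UnitBallLieAlgebraCasimirRootPlanes    -- ★ (b1, first half) p846511: the six root identities, integrability; brings ★ (a1′), ★ (a1), ★ (b0), ★ (a0)
import HarnessLib

/-!
# THE FLAT CASIMIR IDENTITY ON `𝔲(2,1)`: `Φ_{∂(ω)f}(θ) = −Δ_θΦ_f(θ) − 2·Σ_{i<j} ∂_{e_i−e_j}Φ_f(θ)∕(θ_i−θ_j)` (= `−π⁻¹Δ_θ(π·Φ_f)`) at every regular point of the torus
# (ROAD «A6-IV» brick (b1), second half — the CRITICAL-PATH HEAD; Harish-Chandra 1957 «Differential operators on a semisimple Lie algebra» Thm. 1 (`p = ω`); Helgason GGA Ch. II §5; Warner II §8.4.1)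

Topic `Geometry/ComplexHyperbolic`; namespace `Literature.Geometry.ComplexHyperbolic.BallModel`.  THEOREMS ONLY (no `def`, no instance, no notation, no axiom, no named fact, no `sorry`).
Cell `pub/hodgecm-mathlib`, ENGINE T1 (crux H413 = `stmt-HodgeConjecture-24833`); ROAD A, design of record `DESIGN-A6-InHouse-v2-ArchitectureIV` 93542b84 (LEAD T11-4), SPEC fb65bd65 (b1);
author F0P3a-p05 (g15) (ROAD A owner), 2026-09-01.

THE THEOREM.  `G = U(2,1)` (ball model), `μ` finite on compacta and right-invariant, `f ∈ C^∞_c(M₃(ℂ); E)` ambient, `Φ_f(θ) = lieOrbital μ f (torusH θ) = ∫_G f(Ad_h diag(iθ)) dμ`, `θ` REGULAR (`rootProduct θ ≠ 0`):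
  **`lieOrbital μ (lieLaplacian f) (torusH θ) = −Σ_k D²Φ_f(θ)[e_k,e_k] − Σ_{i<j} (2∕(θ_i−θ_j)) • DΦ_f(θ)[e_i − e_j]`**
i.e. `Φ_{∂(ω)f} = −(Δ_θ + 2∇log π·∇)Φ_f = −π⁻¹Δ_θ(πΦ_f)` since `Δ_θπ = 0` — Harish-Chandra's radial-part theorem for the Casimir polynomial `ω` of `B = Re tr`, with the SIGN `c₂ = −1` of design v2 (`B|_𝔧 = −Σdθ²`).
PROOF.  ★ (b0) `lieLaplacian_eq_sum_conj` moves the frame: `(∂(ω)f)(Ad_h H) = Σ_a w_a D²f(Ad_h H)[Ad_h E_a]²`; integrate term by term (★ (b1-I) integrability); torus terms `a = 0,1,2` (`w = −1`) are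
`D²Φ_f(θ)[e_k,e_k]` by ★ (a1) `iteratedFDeriv_lieOrbital_torusH_apply` (`torusH e_k = E_k`); root terms `a = 3…8` (`w = ∓½`) are `∓(2∕(θ_i−θ_j))·DΦ_f(θ)[e_i−e_j]·(…)` by the six ★ root
identities of (b1-I) (right-invariance along the block boost∕rotation of the plane's OTHER generator) and ★ (a1) at order one; the weights flip the compact-plane sign so that every plane contributes
`−(2∕(θ_i−θ_j))•DΦ_f[e_i−e_j]`.
HONEST LABEL: HC_CM is proved only modulo the printed citations until rung 0 closes; this is the one analytic identity of HC's holonomic system (design v2 (★2): the cubic equation follows by commutator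
algebra, brick (b3)); it pays nothing by itself.

## References
* [WarnerHASSLG2] G. Warner, *Harmonic Analysis on Semi-Simple Lie Groups II*, Grundlehren 189 (1972), §8.4.1 (`φ_{∂(p)f} = ∂(p̄)φ_f`), §8.4.3.
* [Helgason2000] S. Helgason, *Groups and Geometric Analysis* (2000), Ch. II §5 Thm. 5.? (`Δ(L_𝔤) = π⁻¹ L_𝔧 ∘ π − π⁻¹L_𝔧(π)`).
* [Varadarajan1989] V. S. Varadarajan, *An Introduction to Harmonic Analysis on Semisimple Lie Groups* (1989), §6.3.
-/

set_option autoImplicit false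

noncomputable section

namespace Literature.Geometry.ComplexHyperbolic

namespace BallModel

open _root_.Complex _root_.Matrix _root_.MeasureTheory _root_.Set _root_.Filter _root_.Topology
open scoped Matrix.Norms.Operator ComplexConjugate ContDiff

variable {E : Type*} [NormedAddCommGroup E] [NormedSpace ℝ E] [CompleteSpace E]

/-! ## §1 Small conversions -/

section Conversions

omit [CompleteSpace E] in
/-- `D²f(x)[U,V]` in the `iteratedFDeriv` normal form. [cite: Helgason2000, Ch. II §5] -/
theorem iteratedFDeriv_two_apply_pair {V₀ : Type*} [NormedAddCommGroup V₀] [NormedSpace ℝ V₀] (g : V₀ → E) (x U V : V₀) :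
    iteratedFDeriv ℝ 2 g x ![U, V] = fderiv ℝ (fderiv ℝ g) x U V := by
  rw [iteratedFDeriv_succ_apply_right, iteratedFDeriv_one_apply]
  rfl

omit [CompleteSpace E] in
/-- The weighted sum over the nine basis directions, written out. [cite: WarnerHASSLG2, §8.4.3] -/
theorem sum_lieWeight_smul_eq (F : Fin 9 → E) :
    ∑ a : Fin 9, lieWeight a • F a = -F 0 - F 1 - F 2 - (1 / 2 : ℝ) • F 3 - (1 / 2 : ℝ) • F 4 + (1 / 2 : ℝ) • F 5 + (1 / 2 : ℝ) • F 6 + (1 / 2 : ℝ) • F 7 + (1 / 2 : ℝ) • F 8 := by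
  simp only [Fin.sum_univ_succ, Fin.sum_univ_zero, lieWeight_eq_literal]
  simp
  module

/-- Regularity unpacked: `rootProduct θ ≠ 0` gives the three root differences non-zero. [cite: WarnerHASSLG2, §8.4.1] -/
theorem sub_ne_zero_of_rootProduct_ne_zero {θ : Fin 3 → ℝ} (hθ : rootProduct θ ≠ 0) :
    θ 0 - θ 1 ≠ 0 ∧ θ 0 - θ 2 ≠ 0 ∧ θ 1 - θ 2 ≠ 0 := by
  have h := (rootProduct_ne_zero_iff θ).1 hθ
  exact ⟨sub_ne_zero.2 h.1, sub_ne_zero.2 h.2.1, sub_ne_zero.2 h.2.2⟩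

end Conversions

/-! ## §2 The nine second derivatives of the orbital integrand as derivatives of `Φ_f` -/

section Terms

variable (μ : Measure U21) [IsFiniteMeasureOnCompacts μ] [μ.IsMulRightInvariant] {f : Matrix (Fin 3) (Fin 3) ℂ → E} (hf : ContDiff ℝ ∞ f) (hfc : HasCompactSupport f)
  (θ : Fin 3 → ℝ) (h02 : θ 0 ≠ θ 2) (h12 : θ 1 ≠ θ 2)

include hf hfc h02 h12

omit [μ.IsMulRightInvariant] in
/-- THE TORUS TERMS: `∫ D²f(Ad_h H)[Ad_h torusH u, Ad_h torusH v] dμ = D²Φ_f(θ)[u, v]` (★ (a1) at order two). [cite: WarnerHASSLG2, §8.4.1] -/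
theorem integral_fderiv_two_conj_torusH_torusH (u v : Fin 3 → ℝ) :
    ∫ h : U21, fderiv ℝ (fderiv ℝ f) (mat h * torusH θ * mat h⁻¹) (mat h * torusH u * mat h⁻¹) (mat h * torusH v * mat h⁻¹) ∂μ =
      iteratedFDeriv ℝ 2 (fun θ' : Fin 3 → ℝ => lieOrbital μ f (torusH θ')) θ ![u, v] := by
  rw [iteratedFDeriv_lieOrbital_torusH_apply μ hf hfc θ h02 h12 2 ![u, v]]
  refine integral_congr_ae (Eventually.of_forall fun h => ?_)
  have hv : (fun i : Fin 2 => mat h * torusH ((![u, v] : Fin 2 → Fin 3 → ℝ) i) * mat h⁻¹) = ![mat h * torusH u * mat h⁻¹, mat h * torusH v * mat h⁻¹] := by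
    ext i : 1; fin_cases i <;> simp
  beta_reduce
  rw [hv, iteratedFDeriv_two_apply_pair]
  rfl

omit [μ.IsMulRightInvariant] in
/-- THE FIRST-ORDER TERMS: `∫ Df(Ad_h H)[Ad_h torusH v] dμ = DΦ_f(θ)[v]` (★ (a1) at order one). [cite: WarnerHASSLG2, §8.4.1] -/
theorem integral_fderiv_conj_torusH_torusH (v : Fin 3 → ℝ) :
    ∫ h : U21, fderiv ℝ f (mat h * torusH θ * mat h⁻¹) (mat h * torusH v * mat h⁻¹) ∂μ = fderiv ℝ (fun θ' : Fin 3 → ℝ => lieOrbital μ f (torusH θ')) θ v := by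
  have h := iteratedFDeriv_lieOrbital_torusH_apply μ hf hfc θ h02 h12 1 ![v]
  rw [iteratedFDeriv_one_apply] at h
  simp only [Matrix.cons_val_zero] at h
  rw [h]
  refine integral_congr_ae (Eventually.of_forall fun g => ?_)
  beta_reduce
  rw [iteratedFDeriv_one_apply]
  simp only [Matrix.cons_val_zero]
  rfl

omit [μ.IsMulRightInvariant] in
/-- A ROOT TERM from its identity: `c² • ∫A = −(c₂ • ∫B)`, `∫B = DΦ[v]`, `c ≠ 0` ⇒ `∫A = (−c₂∕c²) • DΦ[v]`. [cite: Helgason2000, Ch. II §5] -/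
theorem integral_eq_smul_fderiv_of_rootIdentity {X : Matrix (Fin 3) (Fin 3) ℂ} {v : Fin 3 → ℝ} {c c₂ : ℝ} (hc : c ≠ 0)
    (hid : c ^ 2 • ∫ h : U21, fderiv ℝ (fderiv ℝ f) (mat h * torusH θ * mat h⁻¹) (mat h * X * mat h⁻¹) (mat h * X * mat h⁻¹) ∂μ =
      -(c₂ • ∫ h : U21, fderiv ℝ f (mat h * torusH θ * mat h⁻¹) (mat h * torusH v * mat h⁻¹) ∂μ)) :
    ∫ h : U21, fderiv ℝ (fderiv ℝ f) (mat h * torusH θ * mat h⁻¹) (mat h * X * mat h⁻¹) (mat h * X * mat h⁻¹) ∂μ =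
      (-c₂ / c ^ 2) • fderiv ℝ (fun θ' : Fin 3 → ℝ => lieOrbital μ f (torusH θ')) θ v := by
  rw [integral_fderiv_conj_torusH_torusH μ hf hfc θ h02 h12 v] at hid
  have hc2 : c ^ 2 ≠ 0 := pow_ne_zero 2 hc
  have h := congrArg (fun z => (c ^ 2)⁻¹ • z) hid
  simp only [inv_smul_smul₀ hc2] at h
  rw [h, smul_neg, smul_smul, ← neg_smul]
  congr 1
  ring

end Terms

/-! ## §3 The flat Casimir identity -/

section Casimir

/-- **THE FLAT CASIMIR IDENTITY ON `𝔲(2,1)` (Harish-Chandra's radial part of `∂(ω)`, `c₂ = −1`)**: for `μ` finite on compacta and right-invariant on `U(2,1)`, `f ∈ C^∞_c(M₃(ℂ); E)` and a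
REGULAR torus point `θ` (`rootProduct θ ≠ 0`),
`lieOrbital μ (lieLaplacian f) (torusH θ) = −Σ_k D²Φ_f(θ)[e_k, e_k] − (2∕(θ₀−θ₁))•DΦ_f(θ)[e₀−e₁] − (2∕(θ₀−θ₂))•DΦ_f(θ)[e₀−e₂] − (2∕(θ₁−θ₂))•DΦ_f(θ)[e₁−e₂]`,
`Φ_f = lieOrbital μ f ∘ torusH` — that is `Φ_{∂(ω)f} = −π⁻¹Δ_θ(π·Φ_f)` (`Δ_θπ = 0`, `∇π∕π = Σ_{i<j}(e_i−e_j)∕(θ_i−θ_j)`). [cite: WarnerHASSLG2, §8.4.1] [cite: Helgason2000, Ch. II §5] -/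
theorem lieOrbital_lieLaplacian_torusH (μ : Measure U21) [IsFiniteMeasureOnCompacts μ] [μ.IsMulRightInvariant] {f : Matrix (Fin 3) (Fin 3) ℂ → E} (hf : ContDiff ℝ ∞ f)
    (hfc : HasCompactSupport f) (θ : Fin 3 → ℝ) (hθ : rootProduct θ ≠ 0) :
    lieOrbital μ (lieLaplacian f) (torusH θ) =
      -(∑ k : Fin 3, iteratedFDeriv ℝ 2 (fun θ' : Fin 3 → ℝ => lieOrbital μ f (torusH θ')) θ ![Pi.single k 1, Pi.single k 1])
        - (2 / (θ 0 - θ 1)) • fderiv ℝ (fun θ' : Fin 3 → ℝ => lieOrbital μ f (torusH θ')) θ (Pi.single 0 1 - Pi.single 1 1)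
        - (2 / (θ 0 - θ 2)) • fderiv ℝ (fun θ' : Fin 3 → ℝ => lieOrbital μ f (torusH θ')) θ (Pi.single 0 1 - Pi.single 2 1)
        - (2 / (θ 1 - θ 2)) • fderiv ℝ (fun θ' : Fin 3 → ℝ => lieOrbital μ f (torusH θ')) θ (Pi.single 1 1 - Pi.single 2 1) := by
  obtain ⟨h01, h02, h12⟩ := sub_ne_zero_of_rootProduct_ne_zero hθ
  have h02' : θ 0 ≠ θ 2 := sub_ne_zero.1 h02
  have h12' : θ 1 ≠ θ 2 := sub_ne_zero.1 h12
  -- abbreviations: the nine root∕torus integrals `A a = ∫ D²f(Ad H)[Ad E_a, Ad E_a]`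
  set A : Fin 9 → E := fun a => ∫ h : U21, fderiv ℝ (fderiv ℝ f) (mat h * torusH θ * mat h⁻¹) (mat h * lieBasis a * mat h⁻¹) (mat h * lieBasis a * mat h⁻¹) ∂μ with hA
  -- Step 1–4: the left-hand side is `Σ_a w_a • A a`
  have hLHS : lieOrbital μ (lieLaplacian f) (torusH θ) = ∑ a : Fin 9, lieWeight a • A a := by
    rw [lieOrbital_def]
    have hpt : ∀ h : U21, lieLaplacian f (mat h * torusH θ * mat h⁻¹) =
        ∑ a : Fin 9, lieWeight a • fderiv ℝ (fderiv ℝ f) (mat h * torusH θ * mat h⁻¹) (mat h * lieBasis a * mat h⁻¹) (mat h * lieBasis a * mat h⁻¹) := by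
      intro h
      rw [lieLaplacian_eq_sum_conj f (mat h * torusH θ * mat h⁻¹) h]
      refine Finset.sum_congr rfl fun a _ => ?_
      rw [iteratedFDeriv_two_apply_pair]
      rfl
    simp_rw [hpt]
    have hI : ∀ a ∈ (Finset.univ : Finset (Fin 9)), Integrable (fun g : U21 => lieWeight a •
        fderiv ℝ (fderiv ℝ f) (mat g * torusH θ * mat g⁻¹) (mat g * lieBasis a * mat g⁻¹) (mat g * lieBasis a * mat g⁻¹)) μ :=
      fun a _ => (integrable_fderiv_two_conj_torusH μ hf hfc θ h02' h12' (lieBasis a) (lieBasis a)).smul (lieWeight a)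
    rw [integral_finsetSum _ hI]
    refine Finset.sum_congr rfl fun a _ => ?_
    rw [integral_smul]
  -- the torus terms
  have hT : ∀ k : Fin 3, ∀ (Ek : Matrix (Fin 3) (Fin 3) ℂ), torusH (Pi.single k 1) = Ek →
      ∫ h : U21, fderiv ℝ (fderiv ℝ f) (mat h * torusH θ * mat h⁻¹) (mat h * Ek * mat h⁻¹) (mat h * Ek * mat h⁻¹) ∂μ =
        iteratedFDeriv ℝ 2 (fun θ' : Fin 3 → ℝ => lieOrbital μ f (torusH θ')) θ ![Pi.single k 1, Pi.single k 1] := by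
    intro k Ek hk
    rw [← hk]
    exact integral_fderiv_two_conj_torusH_torusH μ hf hfc θ h02' h12' _ _
  have hA0 : A 0 = iteratedFDeriv ℝ 2 (fun θ' : Fin 3 → ℝ => lieOrbital μ f (torusH θ')) θ ![Pi.single 0 1, Pi.single 0 1] := hT 0 _ torusH_single_zero
  have hA1 : A 1 = iteratedFDeriv ℝ 2 (fun θ' : Fin 3 → ℝ => lieOrbital μ f (torusH θ')) θ ![Pi.single 1 1, Pi.single 1 1] := hT 1 _ torusH_single_one
  have hA2 : A 2 = iteratedFDeriv ℝ 2 (fun θ' : Fin 3 → ℝ => lieOrbital μ f (torusH θ')) θ ![Pi.single 2 1, Pi.single 2 1] := hT 2 _ torusH_single_two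
  -- the root terms
  have hc20 : θ 2 - θ 0 ≠ 0 := fun h => h02 (by linarith)
  have hc21 : θ 2 - θ 1 ≠ 0 := fun h => h12 (by linarith)
  have hc10 : θ 1 - θ 0 ≠ 0 := fun h => h01 (by linarith)
  have hA3 : A 3 = (-(2 * (θ 1 - θ 0)) / (θ 0 - θ 1) ^ 2) • fderiv ℝ (fun θ' : Fin 3 → ℝ => lieOrbital μ f (torusH θ')) θ (Pi.single 0 1 - Pi.single 1 1) :=
    integral_eq_smul_fderiv_of_rootIdentity μ hf hfc θ h02' h12' h01 (rootIdentity_three μ hf hfc θ h02' h12')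
  have hA4 : A 4 = (-(2 * (θ 1 - θ 0)) / (θ 1 - θ 0) ^ 2) • fderiv ℝ (fun θ' : Fin 3 → ℝ => lieOrbital μ f (torusH θ')) θ (Pi.single 0 1 - Pi.single 1 1) :=
    integral_eq_smul_fderiv_of_rootIdentity μ hf hfc θ h02' h12' hc10 (rootIdentity_four μ hf hfc θ h02' h12')
  have hA5 : A 5 = (-(2 * (θ 0 - θ 2)) / (θ 0 - θ 2) ^ 2) • fderiv ℝ (fun θ' : Fin 3 → ℝ => lieOrbital μ f (torusH θ')) θ (Pi.single 0 1 - Pi.single 2 1) :=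
    integral_eq_smul_fderiv_of_rootIdentity μ hf hfc θ h02' h12' h02 (rootIdentity_five μ hf hfc θ h02' h12')
  have hA6 : A 6 = (-(2 * (θ 0 - θ 2)) / (θ 2 - θ 0) ^ 2) • fderiv ℝ (fun θ' : Fin 3 → ℝ => lieOrbital μ f (torusH θ')) θ (Pi.single 0 1 - Pi.single 2 1) :=
    integral_eq_smul_fderiv_of_rootIdentity μ hf hfc θ h02' h12' hc20 (rootIdentity_six μ hf hfc θ h02' h12')
  have hA7 : A 7 = (-(2 * (θ 1 - θ 2)) / (θ 1 - θ 2) ^ 2) • fderiv ℝ (fun θ' : Fin 3 → ℝ => lieOrbital μ f (torusH θ')) θ (Pi.single 1 1 - Pi.single 2 1) :=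
    integral_eq_smul_fderiv_of_rootIdentity μ hf hfc θ h02' h12' h12 (rootIdentity_seven μ hf hfc θ h02' h12')
  have hA8 : A 8 = (-(2 * (θ 1 - θ 2)) / (θ 2 - θ 1) ^ 2) • fderiv ℝ (fun θ' : Fin 3 → ℝ => lieOrbital μ f (torusH θ')) θ (Pi.single 1 1 - Pi.single 2 1) :=
    integral_eq_smul_fderiv_of_rootIdentity μ hf hfc θ h02' h12' hc21 (rootIdentity_eight μ hf hfc θ h02' h12')
  -- assemble
  rw [hLHS, sum_lieWeight_smul_eq, hA0, hA1, hA2, hA3, hA4, hA5, hA6, hA7, hA8, Fin.sum_univ_three]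
  -- scalar bookkeeping
  have e3 : (-(2 * (θ 1 - θ 0)) / (θ 0 - θ 1) ^ 2 : ℝ) = 2 / (θ 0 - θ 1) := by field_simp; ring
  have e4 : (-(2 * (θ 1 - θ 0)) / (θ 1 - θ 0) ^ 2 : ℝ) = 2 / (θ 0 - θ 1) := by
    have : (θ 1 - θ 0) ^ 2 = (θ 0 - θ 1) ^ 2 := by ring
    rw [this]; field_simp; ring
  have e5 : (-(2 * (θ 0 - θ 2)) / (θ 0 - θ 2) ^ 2 : ℝ) = -(2 / (θ 0 - θ 2)) := by field_simp
  have e6 : (-(2 * (θ 0 - θ 2)) / (θ 2 - θ 0) ^ 2 : ℝ) = -(2 / (θ 0 - θ 2)) := by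
    have : (θ 2 - θ 0) ^ 2 = (θ 0 - θ 2) ^ 2 := by ring
    rw [this]; field_simp
  have e7 : (-(2 * (θ 1 - θ 2)) / (θ 1 - θ 2) ^ 2 : ℝ) = -(2 / (θ 1 - θ 2)) := by field_simp
  have e8 : (-(2 * (θ 1 - θ 2)) / (θ 2 - θ 1) ^ 2 : ℝ) = -(2 / (θ 1 - θ 2)) := by
    have : (θ 2 - θ 1) ^ 2 = (θ 1 - θ 2) ^ 2 := by ring
    rw [this]; field_simp
  rw [e3, e4, e5, e6, e7, e8]
  module

/-- **THE SAME IN THE `liePhi` CURRENCY (directional form)**: with `Φ = lieOrbital μ f ∘ torusH` and `π = rootProduct`,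
`π(θ) • lieOrbital μ (lieLaplacian f) (torusH θ) + π(θ) • Σ_k D²Φ(θ)[e_k,e_k] + Σ_{i<j} (2π(θ)∕(θ_i−θ_j)) • DΦ(θ)[e_i−e_j] = 0` — the form `π·Φ_{∂(ω)f} = −(πΔΦ + 2∇π·∇Φ) = −Δ(πΦ)`
(the last equality, `Δπ = 0` + Leibniz, is left to the consumer (b3), which owns the constant-coefficient calculus on `𝔧`). [cite: WarnerHASSLG2, §8.4.1] [cite: Helgason2000, Ch. II §5] -/
theorem rootProduct_smul_lieOrbital_lieLaplacian_torusH (μ : Measure U21) [IsFiniteMeasureOnCompacts μ] [μ.IsMulRightInvariant] {f : Matrix (Fin 3) (Fin 3) ℂ → E}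
    (hf : ContDiff ℝ ∞ f) (hfc : HasCompactSupport f) (θ : Fin 3 → ℝ) (hθ : rootProduct θ ≠ 0) :
    rootProduct θ • lieOrbital μ (lieLaplacian f) (torusH θ) +
        rootProduct θ • (∑ k : Fin 3, iteratedFDeriv ℝ 2 (fun θ' : Fin 3 → ℝ => lieOrbital μ f (torusH θ')) θ ![Pi.single k 1, Pi.single k 1]) +
        (2 * ((θ 0 - θ 2) * (θ 1 - θ 2))) • fderiv ℝ (fun θ' : Fin 3 → ℝ => lieOrbital μ f (torusH θ')) θ (Pi.single 0 1 - Pi.single 1 1) +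
        (2 * ((θ 0 - θ 1) * (θ 1 - θ 2))) • fderiv ℝ (fun θ' : Fin 3 → ℝ => lieOrbital μ f (torusH θ')) θ (Pi.single 0 1 - Pi.single 2 1) +
        (2 * ((θ 0 - θ 1) * (θ 0 - θ 2))) • fderiv ℝ (fun θ' : Fin 3 → ℝ => lieOrbital μ f (torusH θ')) θ (Pi.single 1 1 - Pi.single 2 1) = 0 := by
  obtain ⟨h01, h02, h12⟩ := sub_ne_zero_of_rootProduct_ne_zero hθ
  rw [lieOrbital_lieLaplacian_torusH μ hf hfc θ hθ, rootProduct]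
  have e1 : (θ 0 - θ 1) * (θ 0 - θ 2) * (θ 1 - θ 2) * (2 / (θ 0 - θ 1)) = 2 * ((θ 0 - θ 2) * (θ 1 - θ 2)) := by field_simp
  have e2 : (θ 0 - θ 1) * (θ 0 - θ 2) * (θ 1 - θ 2) * (2 / (θ 0 - θ 2)) = 2 * ((θ 0 - θ 1) * (θ 1 - θ 2)) := by field_simp
  have e3 : (θ 0 - θ 1) * (θ 0 - θ 2) * (θ 1 - θ 2) * (2 / (θ 1 - θ 2)) = 2 * ((θ 0 - θ 1) * (θ 0 - θ 2)) := by field_simp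
  simp only [smul_sub, smul_neg, smul_smul, e1, e2, e3]
  abel

end Casimir

end BallModel

end Literature.Geometry.ComplexHyperbolic

end
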